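import Literature.RingTheory.Flat.FiniteRegularFree
import HarnessLib

/-!
# Flatness of a morphism between regular schemes from dimensions and zero-dimensional fibres
# («miracle flatness», Matsumura Thm. 23.1 / The Stacks Project 00R4 with a regular source, stalkwise)

Topic `Literature/AlgebraicGeometry/Morphisms`; namespace `Literature.AlgebraicGeometry.Morphisms`.  THEOREMS ONLY.
Cell hodgecm-mathlib, fan B, row VI-5 (`AlbaneseTraceOfFiniteQuotient`), package P1 (flatness of the finite quotient
`p : X → X/Δ` when `X` and `X/Δ` are smooth), file P1b-1 of the plan announced 2026-08-28T03:1xZ: the scheme-level,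
stalkwise form of the tree's `Literature.RingTheory.Flat.flat_of_isRegularLocalRing_of_maximalIdeal_pow_le`
(Matsumura 23.1 for a local homomorphism of regular local rings of the same dimension with `𝔪_A 𝒪` primary).

* `Flat.of_isRegularLocalRing_stalk` — a morphism of schemes `f : X ⟶ Y` is FLAT as soon as, at every `x ∈ X`:
  the stalks `𝒪_{X,x}` and `𝒪_{Y,f x}` are regular local rings of the same Krull dimension and
  `𝔪_{f x} 𝒪_{X,x}` contains a power of `𝔪_x` (i.e. the fibre of `f` through `x` is zero-dimensional at `x`).
  Mathlib's `AlgebraicGeometry.Flat` is tested on stalk maps (`Flat.of_stalkMap`).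

The hypotheses are discharged, for a finite (or locally quasi-finite) morphism between smooth equidimensional schemes
over a field, in the sequel files of package P1 (regularity of the stalks of smooth schemes:
`Resolution.isRegularLocalRing_stalk_of_smooth`; dimensions; primary-ness from quasi-finiteness).  HC_CM is proved
only modulo the 7 printed citations until rung 0 closes; nothing here changes that.

## References
* [Matsumura1987] H. Matsumura, *Commutative Ring Theory*, CUP 1986, Thm. 23.1 (and 17.4 (iii), 22.3).
* The Stacks Project, Tag 00R4.
-/

noncomputable section

open CategoryTheory AlgebraicGeometry IsLocalRing

universe u

namespace Literature.AlgebraicGeometry.Morphisms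

/-- **Miracle flatness, stalkwise (regular source and target).**  Let `f : X ⟶ Y` be a morphism of schemes such
that for every `x ∈ X` the local rings `𝒪_{X,x}` and `𝒪_{Y,f x}` are regular of the same Krull dimension and
some power of `𝔪_x` lies in `𝔪_{f x} 𝒪_{X,x}`.  Then `f` is flat: each stalk map `𝒪_{Y,f x} → 𝒪_{X,x}` is a local
homomorphism of regular local rings to which Matsumura 23.1 applies (a regular system of parameters of
`𝒪_{Y,f x}` is an `𝒪_{X,x}`-regular sequence, `Literature.RingTheory.Flat.flat_of_isRegularLocalRing_of_maximalIdeal_pow_le`).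
[cite: Matsumura1987, Thm. 23.1] -/
theorem Flat.of_isRegularLocalRing_stalk {X Y : Scheme.{u}} (f : X ⟶ Y)
    (hX : ∀ x : X, IsRegularLocalRing (X.presheaf.stalk x))
    (hY : ∀ x : X, IsRegularLocalRing (Y.presheaf.stalk (f.base x)))
    (hdim : ∀ x : X, ringKrullDim (X.presheaf.stalk x) = ringKrullDim (Y.presheaf.stalk (f.base x)))
    (hprim : ∀ x : X, ∃ N : ℕ, maximalIdeal (X.presheaf.stalk x) ^ N ≤
      (maximalIdeal (Y.presheaf.stalk (f.base x))).map (f.stalkMap x).hom) :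
    Flat f := by
  refine Flat.of_stalkMap f fun x => ?_
  haveI := hX x
  haveI := hY x
  letI : Algebra (Y.presheaf.stalk (f.base x)) (X.presheaf.stalk x) := (f.stalkMap x).hom.toAlgebra
  haveI : IsLocalHom (algebraMap (Y.presheaf.stalk (f.base x)) (X.presheaf.stalk x)) :=
    inferInstanceAs (IsLocalHom (f.stalkMap x).hom)
  exact Literature.RingTheory.Flat.flat_of_isRegularLocalRing_of_maximalIdeal_pow_le (hdim x) (hprim x)

end Literature.AlgebraicGeometry.Morphisms

end
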